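import Summits.Ventures.PercRepro.S1SpreadSlackZeroTwo

/-!
# PercRepro — THE SLACK-ZERO STRUCTURE THEOREM, PART C: THE CASE `s = 4` IS IMPOSSIBLE (p1, gen 36)

`proofs/P1-S2-CORANK6.md` §4u. A `4`-circuit `C = {p₁, p₂, p₃, p₄}` made of the private points of four triangles `T₁ … T₄`
(each meets `C` only in its private point) under the budget `4`: the chains (`chain_four`, in every order; the second step
always brings a new point) say `T_c ⊆ C ∪ T_a ∪ T_b` or `T_d ⊆ C ∪ T_a ∪ T_b ∪ T_c`. CASE I, some `T_c ⊆ C ∪ T_a ∪ T_b`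
(**`not_four_private_caseI`**): `T_c ∖ C = {x, y}` with `x ∈ T_a`, `y ∈ T_b`; `T_a` and `T_b` are disjoint (else a three-cycle,
`six_of_three_triangles`); the chain in the order `c, a, b, d` puts `T_d ∖ C` inside `{x, x'} ∪ {y, y'}` (`T_a ∖ C = {x, x'}`,
`T_b ∖ C = {y, y'}`); if `T_d` contains `x` or `y` then `T_c` meets `T_a`, `T_b`, `T_d` (`not_three_triangles_meeting`); otherwise
`T_d ∖ C = {x', y'}` and `T_a ∪ T_b ∪ {p_c, p_d}` is an eight-point set of rank `≤ 4` — against the spread hypothesis `h9`.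
CASE II, no such containment (**`not_four_private`**): `T₄ ∖ C` lies in `T₁ ∪ T₂ ∪ T₃` but in no union of two of them, which
needs three points. Nothing about any cell is claimed. Axioms: standard.
-/

open scoped Matroid

namespace PercRepro

namespace S1

open Set

variable {α : Type}

/-- **`s = 4`, case I with the labels fixed**: `x ∈ T_c ∩ T_a`, `y ∈ T_c ∩ T_b` outside `C`; the budget in the order `c, a, b, d`. -/
theorem not_four_private_caseI_aux (M : Matroid α) [M.Finite]
    (hC1 : ∀ L ⊆ M.E, M.eRk L = 2 → L.ncard ≤ 3)
    (h9 : ∀ X ⊆ M.E, X.ncard ≤ 9 → X.encard ≤ M.eRk X + 3)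
    (hno : ¬ ∃ W ⊆ M.E, W.ncard = 6 ∧ M.eRk W ≤ 3)
    {C Ta Tb Tc Td : Set α} (hC : M.IsCircuit C) (hC4 : C.ncard = 4)
    (hTa : M.IsCircuit Ta) (hTa3 : Ta.ncard = 3) (hTb : M.IsCircuit Tb) (hTb3 : Tb.ncard = 3)
    (hTc : M.IsCircuit Tc) (hTc3 : Tc.ncard = 3) (hTd : M.IsCircuit Td) (hTd3 : Td.ncard = 3)
    (hab : Ta ≠ Tb) (hac : Ta ≠ Tc) (had : Ta ≠ Td) (hbc : Tb ≠ Tc) (hbd : Tb ≠ Td) (hcd : Tc ≠ Td)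
    {pa pb pc pd : α} (hpaT : pa ∈ Ta) (hpaC : pa ∈ C) (hpbT : pb ∈ Tb) (hpbC : pb ∈ C)
    (hpcT : pc ∈ Tc) (hpcC : pc ∈ C) (hpdT : pd ∈ Td) (hpdC : pd ∈ C)
    (hTaC : Ta ∩ C ⊆ {pa}) (hTbC : Tb ∩ C ⊆ {pb}) (hTcC : Tc ∩ C ⊆ {pc}) (hTdC : Td ∩ C ⊆ {pd})
    (hpca : pc ∉ Ta) (hpcb : pc ∉ Tb) (hpda : pd ∉ Ta) (hpdb : pd ∉ Tb) (hpcd : pc ≠ pd)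
    {x y : α} (hxTc : x ∈ Tc) (hxC : x ∉ C) (hxTa : x ∈ Ta) (hyTc : y ∈ Tc) (hyC : y ∉ C) (hyTb : y ∈ Tb) (hxy : x ≠ y)
    (hbud : (C ∪ Tc ∪ Ta ∪ Tb ∪ Td).ncard ≤ (M.eRk (C ∪ Tc ∪ Ta ∪ Tb ∪ Td)).toNat + 4) : False := by
  have hTafin : Ta.Finite := M.ground_finite.subset hTa.subset_ground
  have hTbfin : Tb.Finite := M.ground_finite.subset hTb.subset_ground
  have hTcfin : Tc.Finite := M.ground_finite.subset hTc.subset_ground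
  have hTdfin : Td.Finite := M.ground_finite.subset hTd.subset_ground
  -- two points of a triangle in another triangle: impossible
  have two_in : ∀ {T T' : Set α}, M.IsCircuit T → T.ncard = 3 → M.IsCircuit T' → T'.ncard = 3 → T ≠ T' →
      ∀ {v w : α}, v ≠ w → v ∈ T → v ∈ T' → w ∈ T → w ∈ T' → False := by
    intro T T' hT hT3 hT' hT'3 hne v w hvw hvT hvT' hwT hwT'
    have := S2.ncard_inter_le_one_of_triangles M hC1 hT hT3 hT' hT'3 hne
    have hp : ({v, w} : Set α) ⊆ T ∩ T' := by
      intro z hz; rcases hz with rfl | rfl; exact ⟨hvT, hvT'⟩; exact ⟨hwT, hwT'⟩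
    have h2 := Set.ncard_le_ncard hp ((M.ground_finite.subset hT.subset_ground).subset inter_subset_left)
    rw [Set.ncard_pair hvw] at h2
    omega
  -- `T_a` and `T_b` are disjoint
  have hdisj : Disjoint Ta Tb := by
    by_contra hmeet
    exact six_of_three_triangles M hC1 hno hTa hTa3 hTb hTb3 hTc hTc3 hab hac hbc hxTa hxTc hyTb hyTc hxy hmeet
  -- the second points `x' ∈ T_a ∖ C`, `y' ∈ T_b ∖ C`
  have hTa2 : (Ta \ C).ncard = 2 := ncard_sdiff_eq_two_of_inter M hTa hTa3 hpaT hpaC hTaC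
  have hTb2 : (Tb \ C).ncard = 2 := ncard_sdiff_eq_two_of_inter M hTb hTb3 hpbT hpbC hTbC
  have hTc2 : (Tc \ C).ncard = 2 := ncard_sdiff_eq_two_of_inter M hTc hTc3 hpcT hpcC hTcC
  have hTd2 : (Td \ C).ncard = 2 := ncard_sdiff_eq_two_of_inter M hTd hTd3 hpdT hpdC hTdC
  obtain ⟨x', hx'Ta, hx'x⟩ := Set.exists_ne_of_one_lt_ncard (by omega : 1 < (Ta \ C).ncard) x
  obtain ⟨y', hy'Tb, hy'y⟩ := Set.exists_ne_of_one_lt_ncard (by omega : 1 < (Tb \ C).ncard) y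
  -- the two points of `T ∖ C` are the only ones
  have only_two : ∀ {T : Set α}, T.Finite → (T \ C).ncard = 2 → ∀ {v w : α}, v ≠ w → v ∈ T \ C → w ∈ T \ C →
      ∀ z ∈ T \ C, z = v ∨ z = w := by
    intro T hTfin h2 v w hvw hv hw z hz
    by_contra hcon
    push Not at hcon
    have : 3 ≤ (T \ C).ncard := by
      have hp : ({z, v, w} : Set α) ⊆ T \ C := by
        intro q hq; rcases hq with rfl | rfl | rfl; exact hz; exact hv; exact hw
      have := Set.ncard_le_ncard hp (hTfin.subset sdiff_subset)
      rwa [Set.ncard_insert_of_notMem (by simp only [mem_insert_iff, mem_singleton_iff, not_or]; exact hcon)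
        (toFinite _), Set.ncard_pair hvw] at this
    omega
  -- the chain in the order `c, a, b, d`
  have hTcC' : ¬ Tc ⊆ C := tri_not_subset_four M hC hC4 hTc hTc3
  have hnot_ac : ¬ Ta ⊆ C ∪ Tc :=
    not_subset_union_of_two_outside M hC1 hTa hTa3 hTc hTc3 hac hxTa hxC hx'Ta.1 hx'Ta.2 (Ne.symm hx'x)
  have hTd_sub : Td ⊆ C ∪ Tc ∪ Ta ∪ Tb := by
    rcases chain_four M hC hC4 hTc hTcC' hTa hnot_ac hTb hTd hbud with h | h
    · exfalso
      -- `y' ∈ T_b ∖ C` lies in `T_c` (two points with `y`) or in `T_a` (disjoint)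
      rcases h hy'Tb.1 with (h' | h') | h'
      · exact hy'Tb.2 h'
      · exact two_in hTb hTb3 hTc hTc3 hbc hy'y hy'Tb.1 h' hyTb hyTc
      · exact Set.disjoint_left.1 hdisj h' hy'Tb.1
    · exact h
  -- `T_d` does not contain `x` or `y` (else `T_c` meets three triangles)
  have hxTd : x ∉ Td := fun hxTd =>
    not_three_triangles_meeting M hC1 h9 hno hTc hTc3 hTa hTa3 hac (Set.not_disjoint_iff.2 ⟨x, hxTa, hxTc⟩)
      hTb hTb3 hbc (Set.not_disjoint_iff.2 ⟨y, hyTb, hyTc⟩) hTd hTd3 (Ne.symm hcd)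
      (Set.not_disjoint_iff.2 ⟨x, hxTd, hxTc⟩) hab had hbd
  have hyTd : y ∉ Td := fun hyTd =>
    not_three_triangles_meeting M hC1 h9 hno hTc hTc3 hTa hTa3 hac (Set.not_disjoint_iff.2 ⟨x, hxTa, hxTc⟩)
      hTb hTb3 hbc (Set.not_disjoint_iff.2 ⟨y, hyTb, hyTc⟩) hTd hTd3 (Ne.symm hcd)
      (Set.not_disjoint_iff.2 ⟨y, hyTd, hyTc⟩) hab had hbd
  -- hence `T_d ∖ C = {x', y'}`
  have hTd_pts : ∀ z ∈ Td \ C, z = x' ∨ z = y' := by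
    intro z hz
    rcases hTd_sub hz.1 with ((h | h) | h) | h
    · exact absurd h hz.2
    · -- `z ∈ T_c ∖ C = {x, y}`
      rcases only_two hTcfin hTc2 hxy ⟨hxTc, hxC⟩ ⟨hyTc, hyC⟩ z ⟨h, hz.2⟩ with rfl | rfl
      · exact absurd hz.1 hxTd
      · exact absurd hz.1 hyTd
    · rcases only_two hTafin hTa2 (Ne.symm hx'x) ⟨hxTa, hxC⟩ hx'Ta z ⟨h, hz.2⟩ with rfl | rfl
      · exact absurd hz.1 hxTd
      · exact Or.inl rfl
    · rcases only_two hTbfin hTb2 (Ne.symm hy'y) ⟨hyTb, hyC⟩ hy'Tb z ⟨h, hz.2⟩ with rfl | rfl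
      · exact absurd hz.1 hyTd
      · exact Or.inr rfl
  obtain ⟨v, w, hvw, hvTd, hvC, hwTd, hwC⟩ := exists_two_outside M hTd hTd3 hTdC
  have hx'y' : x' ≠ y' := fun h => Set.disjoint_left.1 hdisj hx'Ta.1 (h ▸ hy'Tb.1)
  have hx'Td : x' ∈ Td ∧ y' ∈ Td := by
    rcases hTd_pts v ⟨hvTd, hvC⟩ with rfl | rfl <;> rcases hTd_pts w ⟨hwTd, hwC⟩ with rfl | rfl
    · exact absurd rfl hvw
    · exact ⟨hvTd, hwTd⟩
    · exact ⟨hwTd, hvTd⟩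
    · exact absurd rfl hvw
  -- the four-cycle: `T_a ∪ T_b ∪ {p_c, p_d}` has eight points and rank `≤ 4`
  have hpc_cl : pc ∈ M.closure (Ta ∪ Tb) := by
    have h1 : Tc ⊆ M.closure {x, y} := tri_subset_closure_pair M hTc hTc3 hxTc hyTc hxy
    have h2 : ({x, y} : Set α) ⊆ Ta ∪ Tb := by
      intro z hz; rcases hz with rfl | rfl; exact Or.inl hxTa; exact Or.inr hyTb
    exact (h1.trans (M.closure_subset_closure h2)) hpcT
  have hpd_cl : pd ∈ M.closure (Ta ∪ Tb) := by
    have h1 : Td ⊆ M.closure {x', y'} := tri_subset_closure_pair M hTd hTd3 hx'Td.1 hx'Td.2 hx'y'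
    have h2 : ({x', y'} : Set α) ⊆ Ta ∪ Tb := by
      intro z hz; rcases hz with rfl | rfl; exact Or.inl hx'Ta.1; exact Or.inr hy'Tb.1
    exact (h1.trans (M.closure_subset_closure h2)) hpdT
  set W : Set α := Ta ∪ Tb ∪ {pc, pd} with hW
  have hWE : W ⊆ M.E := by
    refine union_subset (union_subset hTa.subset_ground hTb.subset_ground) ?_
    intro z hz; rcases hz with rfl | rfl; exact hTc.subset_ground hpcT; exact hTd.subset_ground hpdT
  have hWrk : M.eRk W ≤ 4 := by
    have hcl : ({pc, pd} : Set α) ⊆ M.closure (Ta ∪ Tb) := by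
      intro z hz; rcases hz with rfl | rfl; exact hpc_cl; exact hpd_cl
    rw [hW, eRk_union_eq_of_subset_closure M hcl]
    have := M.eRk_union_le_eRk_add_eRk Ta Tb
    rw [eRk_eq_two_of_tri M hTa hTa3, eRk_eq_two_of_tri M hTb hTb3] at this
    exact this.trans (by norm_num)
  have hW8 : W.ncard = 8 := by
    have h6 : (Ta ∪ Tb).ncard = 6 := by
      rw [Set.ncard_union_eq hdisj hTafin hTbfin, hTa3, hTb3]
    have hpcW : pc ∉ Ta ∪ Tb := fun h => by rcases h with h | h; exact hpca h; exact hpcb h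
    have hpdW : pd ∉ Ta ∪ Tb := fun h => by rcases h with h | h; exact hpda h; exact hpdb h
    have hu : W = insert pc (insert pd (Ta ∪ Tb)) := by
      rw [hW]; ext z; simp only [mem_union, mem_insert_iff, mem_singleton_iff]; tauto
    rw [hu, Set.ncard_insert_of_notMem (by
      simp only [mem_insert_iff, not_or]; exact ⟨hpcd, hpcW⟩) ((hTafin.union hTbfin).insert pd),
      Set.ncard_insert_of_notMem hpdW (hTafin.union hTbfin), h6]
  have h := h9 W hWE (by omega)
  have hWfin : W.Finite := M.ground_finite.subset hWE
  rw [← coe_toNat_eRk M hWE, ← hWfin.cast_ncard_eq, hW8] at h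
  have h' : 8 ≤ (M.eRk W).toNat + 3 := by exact_mod_cast h
  have h4 : (M.eRk W).toNat ≤ 4 := by
    have := hWrk
    rw [← coe_toNat_eRk M hWE] at this
    exact_mod_cast this
  omega

/-- **`s = 4`, case I**: some `T_c ⊆ C ∪ T_a ∪ T_b` is impossible (the budget in the order `c, a, b, d`). -/
theorem not_four_private_caseI (M : Matroid α) [M.Finite]
    (hC1 : ∀ L ⊆ M.E, M.eRk L = 2 → L.ncard ≤ 3)
    (h9 : ∀ X ⊆ M.E, X.ncard ≤ 9 → X.encard ≤ M.eRk X + 3)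
    (hno : ¬ ∃ W ⊆ M.E, W.ncard = 6 ∧ M.eRk W ≤ 3)
    {C Ta Tb Tc Td : Set α} (hC : M.IsCircuit C) (hC4 : C.ncard = 4)
    (hTa : M.IsCircuit Ta) (hTa3 : Ta.ncard = 3) (hTb : M.IsCircuit Tb) (hTb3 : Tb.ncard = 3)
    (hTc : M.IsCircuit Tc) (hTc3 : Tc.ncard = 3) (hTd : M.IsCircuit Td) (hTd3 : Td.ncard = 3)
    (hab : Ta ≠ Tb) (hac : Ta ≠ Tc) (had : Ta ≠ Td) (hbc : Tb ≠ Tc) (hbd : Tb ≠ Td) (hcd : Tc ≠ Td)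
    {pa pb pc pd : α} (hpaT : pa ∈ Ta) (hpaC : pa ∈ C) (hpbT : pb ∈ Tb) (hpbC : pb ∈ C)
    (hpcT : pc ∈ Tc) (hpcC : pc ∈ C) (hpdT : pd ∈ Td) (hpdC : pd ∈ C)
    (hTaC : Ta ∩ C ⊆ {pa}) (hTbC : Tb ∩ C ⊆ {pb}) (hTcC : Tc ∩ C ⊆ {pc}) (hTdC : Td ∩ C ⊆ {pd})
    (hpca : pc ∉ Ta) (hpcb : pc ∉ Tb) (hpda : pd ∉ Ta) (hpdb : pd ∉ Tb) (hpcd : pc ≠ pd)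
    (hcov : Tc ⊆ C ∪ Ta ∪ Tb)
    (hbud : (C ∪ Tc ∪ Ta ∪ Tb ∪ Td).ncard ≤ (M.eRk (C ∪ Tc ∪ Ta ∪ Tb ∪ Td)).toNat + 4) : False := by
  obtain ⟨x, y, hxy, hxTc, hxC, hyTc, hyC⟩ := exists_two_outside M hTc hTc3 hTcC
  have hx : x ∈ Ta ∪ Tb := by rcases hcov hxTc with (h | h) | h; exact absurd h hxC; exact Or.inl h; exact Or.inr h
  have hy : y ∈ Ta ∪ Tb := by rcases hcov hyTc with (h | h) | h; exact absurd h hyC; exact Or.inl h; exact Or.inr h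
  have hTcfin : Tc.Finite := M.ground_finite.subset hTc.subset_ground
  have two_in : ∀ {T' : Set α}, M.IsCircuit T' → T'.ncard = 3 → Tc ≠ T' → x ∈ T' → y ∈ T' → False := by
    intro T' hT' hT'3 hne hxT' hyT'
    have := S2.ncard_inter_le_one_of_triangles M hC1 hTc hTc3 hT' hT'3 hne
    have hp : ({x, y} : Set α) ⊆ Tc ∩ T' := by
      intro z hz; rcases hz with rfl | rfl; exact ⟨hxTc, hxT'⟩; exact ⟨hyTc, hyT'⟩
    have h2 := Set.ncard_le_ncard hp (hTcfin.subset inter_subset_left)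
    rw [Set.ncard_pair hxy] at h2
    omega
  rcases hx with hxa | hxb
  · rcases hy with hya | hyb
    · exact two_in hTa hTa3 (Ne.symm hac) hxa hya
    · exact not_four_private_caseI_aux M hC1 h9 hno hC hC4 hTa hTa3 hTb hTb3 hTc hTc3 hTd hTd3 hab hac had hbc hbd hcd
        hpaT hpaC hpbT hpbC hpcT hpcC hpdT hpdC hTaC hTbC hTcC hTdC hpca hpcb hpda hpdb hpcd hxTc hxC hxa hyTc hyC hyb
        hxy hbud
  · rcases hy with hya | hyb
    · have hbud' : (C ∪ Tc ∪ Tb ∪ Ta ∪ Td).ncard ≤ (M.eRk (C ∪ Tc ∪ Tb ∪ Ta ∪ Td)).toNat + 4 := by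
        rw [show C ∪ Tc ∪ Tb ∪ Ta ∪ Td = C ∪ Tc ∪ Ta ∪ Tb ∪ Td by ac_rfl]; exact hbud
      exact not_four_private_caseI_aux M hC1 h9 hno hC hC4 hTb hTb3 hTa hTa3 hTc hTc3 hTd hTd3 (Ne.symm hab) hbc hbd hac
        had hcd hpbT hpbC hpaT hpaC hpcT hpcC hpdT hpdC hTbC hTaC hTcC hTdC hpcb hpca hpdb hpda hpcd hxTc hxC hxb hyTc hyC
        hya hxy hbud'
    · exact two_in hTb hTb3 (Ne.symm hbc) hxb hyb

/-- **`s = 4` is impossible**: a `4`-circuit cannot consist of the private points of four triangles under the budget `4`. -/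
theorem not_four_private (M : Matroid α) [M.Finite]
    (hC1 : ∀ L ⊆ M.E, M.eRk L = 2 → L.ncard ≤ 3)
    (h9 : ∀ X ⊆ M.E, X.ncard ≤ 9 → X.encard ≤ M.eRk X + 3)
    (hno : ¬ ∃ W ⊆ M.E, W.ncard = 6 ∧ M.eRk W ≤ 3)
    {C T₁ T₂ T₃ T₄ : Set α} (hC : M.IsCircuit C) (hC4 : C.ncard = 4)
    (hT₁ : M.IsCircuit T₁) (hT₁3 : T₁.ncard = 3) (hT₂ : M.IsCircuit T₂) (hT₂3 : T₂.ncard = 3)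
    (hT₃ : M.IsCircuit T₃) (hT₃3 : T₃.ncard = 3) (hT₄ : M.IsCircuit T₄) (hT₄3 : T₄.ncard = 3)
    (h12 : T₁ ≠ T₂) (h13 : T₁ ≠ T₃) (h14 : T₁ ≠ T₄) (h23 : T₂ ≠ T₃) (h24 : T₂ ≠ T₄) (h34 : T₃ ≠ T₄)
    {p₁ p₂ p₃ p₄ : α} (hp₁T : p₁ ∈ T₁) (hp₁C : p₁ ∈ C) (hp₂T : p₂ ∈ T₂) (hp₂C : p₂ ∈ C)
    (hp₃T : p₃ ∈ T₃) (hp₃C : p₃ ∈ C) (hp₄T : p₄ ∈ T₄) (hp₄C : p₄ ∈ C)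
    (hT₁C : T₁ ∩ C ⊆ {p₁}) (hT₂C : T₂ ∩ C ⊆ {p₂}) (hT₃C : T₃ ∩ C ⊆ {p₃}) (hT₄C : T₄ ∩ C ⊆ {p₄})
    (hp₁N : p₁ ∉ T₂ ∧ p₁ ∉ T₃ ∧ p₁ ∉ T₄) (hp₂N : p₂ ∉ T₁ ∧ p₂ ∉ T₃ ∧ p₂ ∉ T₄)
    (hp₃N : p₃ ∉ T₁ ∧ p₃ ∉ T₂ ∧ p₃ ∉ T₄) (hp₄N : p₄ ∉ T₁ ∧ p₄ ∉ T₂ ∧ p₄ ∉ T₃)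
    (hbud : (C ∪ T₁ ∪ T₂ ∪ T₃ ∪ T₄).ncard ≤ (M.eRk (C ∪ T₁ ∪ T₂ ∪ T₃ ∪ T₄)).toNat + 4) : False := by
  have hbudP : ∀ {X : Set α}, X = C ∪ T₁ ∪ T₂ ∪ T₃ ∪ T₄ → X.ncard ≤ (M.eRk X).toNat + 4 := fun h => h ▸ hbud
  have hp12 : p₁ ≠ p₂ := fun h => hp₂N.1 (h ▸ hp₁T)
  have hp13 : p₁ ≠ p₃ := fun h => hp₃N.1 (h ▸ hp₁T)
  have hp14 : p₁ ≠ p₄ := fun h => hp₄N.1 (h ▸ hp₁T)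
  have hp23 : p₂ ≠ p₃ := fun h => hp₃N.2.1 (h ▸ hp₂T)
  have hp24 : p₂ ≠ p₄ := fun h => hp₄N.2.1 (h ▸ hp₂T)
  have hp34 : p₃ ≠ p₄ := fun h => hp₄N.2.2 (h ▸ hp₃T)
  -- case I in the four labellings
  by_cases h3 : T₃ ⊆ C ∪ T₁ ∪ T₂
  · exact not_four_private_caseI M hC1 h9 hno hC hC4 hT₁ hT₁3 hT₂ hT₂3 hT₃ hT₃3 hT₄ hT₄3 h12 h13 h14 h23 h24 h34
      hp₁T hp₁C hp₂T hp₂C hp₃T hp₃C hp₄T hp₄C hT₁C hT₂C hT₃C hT₄C hp₃N.1 hp₃N.2.1 hp₄N.1 hp₄N.2.1 hp34 h3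
      (hbudP (by ac_rfl))
  by_cases h4a : T₄ ⊆ C ∪ T₁ ∪ T₂
  · exact not_four_private_caseI M hC1 h9 hno hC hC4 hT₁ hT₁3 hT₂ hT₂3 hT₄ hT₄3 hT₃ hT₃3 h12 h14 h13 h24 h23
      (Ne.symm h34) hp₁T hp₁C hp₂T hp₂C hp₄T hp₄C hp₃T hp₃C hT₁C hT₂C hT₄C hT₃C hp₄N.1 hp₄N.2.1 hp₃N.1 hp₃N.2.1
      (Ne.symm hp34) h4a (hbudP (by ac_rfl))
  by_cases h4b : T₄ ⊆ C ∪ T₁ ∪ T₃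
  · exact not_four_private_caseI M hC1 h9 hno hC hC4 hT₁ hT₁3 hT₃ hT₃3 hT₄ hT₄3 hT₂ hT₂3 h13 h14 h12 h34
      (Ne.symm h23) (Ne.symm h24) hp₁T hp₁C hp₃T hp₃C hp₄T hp₄C hp₂T hp₂C hT₁C hT₃C hT₄C hT₂C hp₄N.1 hp₄N.2.2
      hp₂N.1 hp₂N.2.1 (Ne.symm hp24) h4b (hbudP (by ac_rfl))
  by_cases h4c : T₄ ⊆ C ∪ T₂ ∪ T₃
  · exact not_four_private_caseI M hC1 h9 hno hC hC4 hT₂ hT₂3 hT₃ hT₃3 hT₄ hT₄3 hT₁ hT₁3 h23 h24 (Ne.symm h12) h34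
      (Ne.symm h13) (Ne.symm h14) hp₂T hp₂C hp₃T hp₃C hp₄T hp₄C hp₁T hp₁C hT₂C hT₃C hT₄C hT₁C hp₄N.2.1 hp₄N.2.2
      hp₁N.1 hp₁N.2.1 (Ne.symm hp14) h4c (hbudP (by ac_rfl))
  -- case II: `T₄ ∖ C ⊆ T₁ ∪ T₂ ∪ T₃` but meets each `T_i` outside the other two: three points
  have hT₁C' : ¬ T₁ ⊆ C := tri_not_subset_four M hC hC4 hT₁ hT₁3
  obtain ⟨a, a', haa', haT₁, haC, ha'T₁, ha'C⟩ := exists_two_outside M hT₁ hT₁3 hT₁C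
  have hnot21 : ¬ T₂ ⊆ C ∪ T₁ := by
    obtain ⟨b, b', hbb', hbT₂, hbC, hb'T₂, hb'C⟩ := exists_two_outside M hT₂ hT₂3 hT₂C
    exact not_subset_union_of_two_outside M hC1 hT₂ hT₂3 hT₁ hT₁3 (Ne.symm h12) hbT₂ hbC hb'T₂ hb'C hbb'
  have h4 : T₄ ⊆ C ∪ T₁ ∪ T₂ ∪ T₃ := by
    rcases chain_four M hC hC4 hT₁ hT₁C' hT₂ hnot21 hT₃ hT₄ hbud with h | h
    · exact absurd h h3
    · exact h
  obtain ⟨q₃, hq₃T₄, hq₃⟩ : ∃ q ∈ T₄, q ∉ C ∪ T₁ ∪ T₂ := by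
    by_contra h; push Not at h; exact h4a h
  obtain ⟨q₂, hq₂T₄, hq₂⟩ : ∃ q ∈ T₄, q ∉ C ∪ T₁ ∪ T₃ := by
    by_contra h; push Not at h; exact h4b h
  obtain ⟨q₁, hq₁T₄, hq₁⟩ : ∃ q ∈ T₄, q ∉ C ∪ T₂ ∪ T₃ := by
    by_contra h; push Not at h; exact h4c h
  simp only [mem_union, not_or] at hq₁ hq₂ hq₃
  have hq₃T₃ : q₃ ∈ T₃ := by
    rcases h4 hq₃T₄ with ((h | h) | h) | h
    · exact absurd h hq₃.1.1
    · exact absurd h hq₃.1.2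
    · exact absurd h hq₃.2
    · exact h
  have hq₂T₂ : q₂ ∈ T₂ := by
    rcases h4 hq₂T₄ with ((h | h) | h) | h
    · exact absurd h hq₂.1.1
    · exact absurd h hq₂.1.2
    · exact h
    · exact absurd h hq₂.2
  have hq₁T₁ : q₁ ∈ T₁ := by
    rcases h4 hq₁T₄ with ((h | h) | h) | h
    · exact absurd h hq₁.1.1
    · exact h
    · exact absurd h hq₁.1.2
    · exact absurd h hq₁.2
  have h12' : q₁ ≠ q₂ := fun h => hq₂.1.2 (h ▸ hq₁T₁)
  have h13' : q₁ ≠ q₃ := fun h => hq₃.1.2 (h ▸ hq₁T₁)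
  have h23' : q₂ ≠ q₃ := fun h => hq₃.2 (h ▸ hq₂T₂)
  have hT₄fin : T₄.Finite := M.ground_finite.subset hT₄.subset_ground
  have hT₄2 : (T₄ \ C).ncard = 2 := ncard_sdiff_eq_two_of_inter M hT₄ hT₄3 hp₄T hp₄C hT₄C
  have : 3 ≤ (T₄ \ C).ncard := by
    have hp : ({q₁, q₂, q₃} : Set α) ⊆ T₄ \ C := by
      intro z hz
      rcases hz with rfl | rfl | rfl
      · exact ⟨hq₁T₄, hq₁.1.1⟩
      · exact ⟨hq₂T₄, hq₂.1.1⟩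
      · exact ⟨hq₃T₄, hq₃.1.1⟩
    have := Set.ncard_le_ncard hp (hT₄fin.subset sdiff_subset)
    rwa [Set.ncard_insert_of_notMem (by simp only [mem_insert_iff, mem_singleton_iff, not_or]; exact ⟨h12', h13'⟩)
      (toFinite _), Set.ncard_pair h23'] at this
  omega

end S1

end PercRepro
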